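import Summits.BirchSwinnertonDyer.BirchSwinnertonDyer.Theorems.ManinLocalTwoThreeCDivisionPoleKill
import HarnessLib

/-!
# The `c`-division witness: the CORE package (holomorphy, presentation, exact stabiliser)

Cell `bsd-f2-manin`, prover seat p2 (gen 20); crux C2 `ManinOddAtFour` (stmt-BirchSwinnertonDyer-22967) and C3 `ManinPrimeToThreeAtNine`
(stmt-22968); an g44's `c`-DIVISION WITNESS (STATUS 2026-08-30T00:06Z).  One existence statement assembled from the nodes N1, N2, N3,
N5 of `…CDivisionPoleKill`:

* `exists_cDivisionWitnessCore` — for a modular parametrisation datum `D` of `W` with `c ≠ 0` and any `a : ℕ` there are `k ≥ 12`,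
  a nonzero cusp form `G ∈ S_k(Γ₀(N))` with INTEGER Fourier coefficients and a holomorphic `F : ℍ → ℂ` with
  `F(τ) = 12·℘_{Λ_W}(E_f(τ))·G(τ)·Δ(τ)^a` off the poles of `℘_{Λ_W}(E_f)`, whose stabiliser in `Γ₀(N)` for the weight
  `k + 12a` action is EXACTLY `Γ^{(c)} = {γ : {∞, γ∞}_f ∈ Λ_W}`: `cuspSymbol D.f γ ∈ Λ_W ↔ F ∣[k + 12a] γ = F`.

What is NOT here (other seats): the growth of `F ∣ g` at the cusps (node N6) and the integer `q`-series of `F` on `ℍ` (node N7,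
Honda at multiplier `1`), and the assembly into `CDivisionWitnessLaw` / UDC.  Everything is proved (standard axioms); no named fact.
BSD is not proved by this file; C2/C3 are not proved by this file.
-/

set_option linter.dupNamespace false
set_option autoImplicit false

noncomputable section

open Complex Filter Topology Set Function
open UpperHalfPlane hiding I
open scoped Real Topology Manifold MatrixGroups PeriodPair ModularForm
open ModularForm SlashInvariantForm ModularFormClass CongruenceSubgroup

open Literature.NumberTheory.EllipticCurves Literature.NumberTheory.EllipticCurves.ModularForms

namespace Summit.BirchSwinnertonDyer.BirchSwinnertonDyer.Theorems.ManinLocalTwoThree.CDivision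

variable {N : ℕ} [NeZero N]

omit [NeZero N] in
/-- The pole-killer `12·G·Δ^a ∘ ofComplex` is analytic on the half-plane. [folklore] -/
theorem analyticOnNhd_twelve_mul_mul_discriminant_pow {k : ℤ} (G : CuspForm (Gamma0 N) k) (a : ℕ) :
    AnalyticOnNhd ℂ ((fun τ : ℍ ↦ 12 * G τ * ModularForm.discriminant τ ^ a) ∘ ofComplex) {z : ℂ | 0 < z.im} := by
  intro z hz
  have hG : AnalyticAt ℂ (⇑G ∘ ofComplex) z :=
    (UpperHalfPlane.mdifferentiable_iff.mp G.holo').analyticAt (isOpen_upperHalfPlaneSet.mem_nhds hz)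
  have hΔ : AnalyticAt ℂ (ModularForm.discriminant ∘ ofComplex) z := analyticOnNhd_discriminant_comp_ofComplex z hz
  have h : AnalyticAt ℂ (fun w : ℂ ↦ (12 : ℂ) * (⇑G ∘ ofComplex) w * (ModularForm.discriminant ∘ ofComplex) w ^ a) z :=
    (analyticAt_const.mul hG).mul (hΔ.pow a)
  exact h

omit [NeZero N] in
/-- The pole-killer transforms with weight `k + 12a` under `Γ₀(N)`: `(12GΔ^a)(γτ) = (cτ + d)^{k + 12a}(12GΔ^a)(τ)`. [folklore] -/
theorem twelve_mul_mul_discriminant_pow_apply_smul {k : ℤ} (G : CuspForm (Gamma0 N) k) (a K : ℕ) (hK : (K : ℤ) = k + 12 * a)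
    (γ : SL(2, ℤ)) (hγ : γ ∈ Gamma0 N) (τ : ℍ) :
    12 * G (γ • τ) * ModularForm.discriminant (γ • τ) ^ a =
      denom γ τ ^ K * (12 * G τ * ModularForm.discriminant τ ^ a) := by
  have hd0 : denom γ τ ≠ 0 := denom_ne_zero γ τ
  have hG : G (γ • τ) = denom γ τ ^ k * G τ := SlashInvariantForm.slash_action_eqn_SL'' G hγ τ
  have hΔ := discriminant_apply_smul γ τ
  have hpow : (denom γ τ ^ K : ℂ) = denom γ τ ^ k * (denom γ τ ^ (12 : ℤ)) ^ a := by
    rw [← zpow_natCast, hK, zpow_add₀ hd0, ← zpow_natCast (denom γ τ ^ (12 : ℤ)) a, ← zpow_mul]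
  rw [hG, hΔ, hpow, mul_pow]
  ring

/-- **The core of the `c`-division witness.**  For a modular parametrisation datum `D` of `W` (Manin constant `c ≠ 0`, Néron pair
`D.L`, `cΛ_f ⊆ Λ_W`) and `a : ℕ`: there are `k ≥ 12`, a nonzero `G ∈ S_k(Γ₀(N))` with integer Fourier coefficients and a
holomorphic `F : ℍ → ℂ` with `F = 12·℘_{Λ_W}(E_f)·G·Δ^a` off the poles and, for every `γ ∈ Γ₀(N)`,
`{∞, γ∞}_f ∈ Λ_W ↔ F ∣[k + 12a] γ = F` (N1 integer presentation of `℘_{c⁻¹Λ_W}(E_f)`, N2 pole killing, N3 invariant extension,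
N5 Manin's lemma). [cite: ShimuraIATAF1971, Thm. 3.52 and Thm. 7.14] [cite: Manin1972, Prop. 1.4] -/
theorem exists_cDivisionWitnessCore {W : WeierstrassCurve ℚ} (D : ModularParametrizationData W N)
    (hc : (D.c : ℂ) ≠ 0) (a : ℕ) :
    ∃ (k : ℤ) (G : CuspForm (Gamma0 N) k) (F : ℍ → ℂ), 12 ≤ k ∧ G ≠ 0 ∧ (∀ m, ∃ z : ℤ, cuspCoeff G m = z) ∧
      MDifferentiable 𝓘(ℂ) 𝓘(ℂ) F ∧
      (∀ τ : ℍ, eichlerIntegral D.f τ ∉ D.L.lattice →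
        12 * ℘[D.L] (eichlerIntegral D.f τ) * G τ * ModularForm.discriminant τ ^ a = F τ) ∧
      (∀ γ : Gamma0 N, cuspSymbol D.f γ ∈ D.L.lattice ↔ F ∣[k + 12 * a] (γ : SL(2, ℤ)) = F) := by
  have hf : D.f ≠ 0 := D.isNewformOf.1.ne_zero
  obtain ⟨k, Fx, G, hk, hX, hint⟩ := exists_int_isXPresentation D hc
  set K : ℕ := k.toNat + 12 * a with hKdef
  have hK : (K : ℤ) = k + 12 * a := by
    rw [hKdef]; push_cast; rw [Int.toNat_of_nonneg (by omega)]
  set Gt : ℍ → ℂ := fun τ ↦ 12 * G τ * ModularForm.discriminant τ ^ a with hGt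
  have hGan : AnalyticOnNhd ℂ (Gt ∘ ofComplex) {z : ℂ | 0 < z.im} :=
    analyticOnNhd_twelve_mul_mul_discriminant_pow G a
  have hGsmul : ∀ γ : SL(2, ℤ), γ ∈ Gamma0 N → ∀ τ : ℍ, Gt (γ • τ) = denom γ τ ^ K * Gt τ :=
    fun γ hγ τ ↦ twelve_mul_mul_discriminant_pow_apply_smul G a K hK γ hγ τ
  -- pole killing for `12GΔ^a`
  have hkill : ∀ z : ℂ, 0 < z.im → eichlerIntegral D.f (ofComplex z) ∈ D.L.lattice →
      0 ≤ meromorphicOrderAt ((fun w : ℂ ↦ ℘[D.L] (eichlerIntegral D.f (ofComplex w))) * (Gt ∘ ofComplex)) z := by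
    intro z hz hzL
    have hΔan : AnalyticAt ℂ (fun w : ℂ ↦ (12 : ℂ) * (ModularForm.discriminant ∘ ofComplex) w ^ a) z :=
      analyticAt_const.mul ((analyticOnNhd_discriminant_comp_ofComplex z hz).pow a)
    have hGan' : AnalyticAt ℂ (⇑G ∘ ofComplex) z :=
      (UpperHalfPlane.mdifferentiable_iff.mp G.holo').analyticAt (isOpen_upperHalfPlaneSet.mem_nhds hz)
    have hXm : MeromorphicAt (fun w : ℂ ↦ ℘[D.L] (eichlerIntegral D.f (ofComplex w))) z :=
      meromorphicAt_weierstrassP_eichlerIntegral D.f D.L hz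
    have hsplit : ((fun w : ℂ ↦ ℘[D.L] (eichlerIntegral D.f (ofComplex w))) * (Gt ∘ ofComplex)) =
        ((fun w : ℂ ↦ ℘[D.L] (eichlerIntegral D.f (ofComplex w))) * (⇑G ∘ ofComplex)) *
          fun w : ℂ ↦ (12 : ℂ) * (ModularForm.discriminant ∘ ofComplex) w ^ a := by
      funext w
      simp only [Pi.mul_apply, comp_apply, hGt]
      ring
    rw [hsplit, meromorphicOrderAt_mul (hXm.mul hGan'.meromorphicAt) hΔan.meromorphicAt]
    exact add_nonneg (meromorphicOrderAt_weierstrassP_mul_nonneg_datum D hc hX hz hzL) hΔan.meromorphicOrderAt_nonneg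
  obtain ⟨F, hFmd, hFinv, hFeq⟩ := exists_invariant_extension_of_cuspSymbol_mem D.f hf D.L Gt K hGan hGsmul hkill
  have hGtmd : MDifferentiable 𝓘(ℂ) 𝓘(ℂ) Gt := UpperHalfPlane.mdifferentiable_iff.mpr hGan.differentiableOn
  have hGt1 : ∃ τ₁ : ℍ, Gt τ₁ ≠ 0 := by
    obtain ⟨τ₁, hτ₁⟩ := DFunLike.ne_iff.mp hX.1
    refine ⟨τ₁, mul_ne_zero (mul_ne_zero (by norm_num) ?_) (pow_ne_zero _ (ModularForm.discriminant_ne_zero τ₁))⟩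
    simpa using hτ₁
  refine ⟨k, G, F, hk, hX.1, hint, hFmd, fun τ hτ ↦ ?_, fun γ ↦ ⟨fun hγ ↦ ?_, fun hγ ↦ ?_⟩⟩
  · rw [← hFeq τ hτ, hGt]
    ring
  · rw [← hK]
    exact hFinv γ hγ
  · rw [← hK] at hγ
    exact cuspSymbol_mem_of_slash_eq D.f hf D.L Gt F K hGtmd hGt1 γ (hGsmul (γ : SL(2, ℤ)) γ.2) hFeq hγ

end Summit.BirchSwinnertonDyer.BirchSwinnertonDyer.Theorems.ManinLocalTwoThree.CDivision

end
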